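import Mathlib.MeasureTheory.Integral.IntervalIntegral.FundThmCalculus
import Mathlib.MeasureTheory.Integral.IntervalIntegral.Periodic
import Literature.Analysis.FunctionSpaces.SmoothParametricIntegral
import HarnessLib

/-!
# Smooth periodic primitives: solving `∂_t H = G - ⟨G⟩` along a circle, with parameters

Analysis/FunctionSpaces support file (continuing `SmoothParametricIntegral`).  The elementary
calculus behind **averaging along the orbits of a circle action** (McDuff–Salamon,
*Introduction to Symplectic Topology*, 3rd ed., proof of Lemma 5.5.6 / Ex. 5.5.7; McLean, GAFA 22
(2012), proof of Lemma 5.17, "parameterized version of the Poincaré Lemma" on the fibres of the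
tube of a divisor): for a smooth `G : ℝ × P → ℝ` (`P` a finite-dimensional parameter space) that
is `T`-periodic in the first variable, the function

  `H (p, t) = ∫₀ᵗ G (s, p) ds - t · A(p)`,   `A(p) = T⁻¹ ∫₀ᵀ G (s, p) ds` (the orbit average),

is **jointly `C^∞` in `(p, t)`**, **`T`-periodic in `t`**, and solves **`∂_t H = G - A`**
(`contDiff_periodicPrimitive`, `periodicPrimitive_add_period`, `hasDerivAt_periodicPrimitive`).
Joint smoothness of the primitive with variable upper limit is reduced to the tree's
`contDiff_parametric_intervalIntegral` by the substitution `∫₀ᵗ G(s) ds = ∫₀¹ t G(tσ) dσ`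
(`integral_eq_integral_unit_smul`).

Everything is proved; no definitions, no named facts (D-0026).

## References

* D. McDuff, D. Salamon, *Introduction to Symplectic Topology*, 3rd ed. (2017), §5.5
  (averaging over a circle action). [McDuffSalamon2017]
* M. McLean, *The growth rate of symplectic homology and affine varieties*, Geom. Funct. Anal. 22
  (2012), proof of Lemma 5.17. [Mclean2012]
-/

noncomputable section

open MeasureTheory Set Filter Topology intervalIntegral
open scoped ContDiff

namespace Literature.Analysis.FunctionSpaces

variable {P : Type*} [NormedAddCommGroup P] [NormedSpace ℝ P] [FiniteDimensional ℝ P]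

/-- **Substitution to the unit interval**: `∫₀ᵗ f(s) ds = ∫₀¹ t f(tσ) dσ` (all real `t`,
including `t = 0` and `t < 0`). [folklore] -/
theorem integral_eq_integral_unit_smul (f : ℝ → ℝ) (t : ℝ) :
    ∫ s in (0 : ℝ)..t, f s = ∫ σ in (0 : ℝ)..1, t * f (t * σ) := by
  have h := intervalIntegral.smul_integral_comp_mul_left f t (a := 0) (b := 1)
  rw [mul_zero, mul_one] at h
  rw [← h, intervalIntegral.integral_const_mul, smul_eq_mul]

/-- **The primitive with variable upper limit depends smoothly on parameters and limit**: for
`G : ℝ × P → ℝ` of class `C^∞`, `(p, t) ↦ ∫₀ᵗ G (s, p) ds` is `C^∞` on `P × ℝ` (substitute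
`s = tσ` and differentiate under the integral sign over `[0, 1]`). [folklore] -/
theorem contDiff_parametric_primitive {G : ℝ × P → ℝ} (hG : ContDiff ℝ ∞ G) :
    ContDiff ℝ ∞ fun x : P × ℝ ↦ ∫ s in (0 : ℝ)..x.2, G (s, x.1) := by
  have hsub : (fun x : P × ℝ ↦ ∫ s in (0 : ℝ)..x.2, G (s, x.1)) =
      fun x : P × ℝ ↦ ∫ σ in (0 : ℝ)..1, x.2 * G (x.2 * σ, x.1) := by
    funext x
    exact integral_eq_integral_unit_smul (fun s ↦ G (s, x.1)) x.2
  rw [hsub]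
  -- the integrand `(σ, (p, t)) ↦ t G(tσ, p)` is smooth
  have hA : ContDiff ℝ ∞ fun y : ℝ × (P × ℝ) ↦ (y.2.2 * y.1, y.2.1) :=
    ((contDiff_snd.comp contDiff_snd).mul contDiff_fst).prodMk (contDiff_fst.comp contDiff_snd)
  have hI : ContDiff ℝ ∞ fun y : ℝ × (P × ℝ) ↦ y.2.2 * G (y.2.2 * y.1, y.2.1) :=
    (contDiff_snd.comp contDiff_snd).mul (hG.comp hA)
  exact contDiff_parametric_intervalIntegral (P := P × ℝ)
    (H := fun y ↦ y.2.2 * G (y.2.2 * y.1, y.2.1)) hI 0 1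

/-- **The orbit average depends smoothly on the parameter**: `p ↦ ∫₀ᵀ G (s, p) ds` is `C^∞`.
[folklore] -/
theorem contDiff_parametric_average {G : ℝ × P → ℝ} (hG : ContDiff ℝ ∞ G) (T : ℝ) :
    ContDiff ℝ ∞ fun p : P ↦ ∫ s in (0 : ℝ)..T, G (s, p) :=
  contDiff_parametric_intervalIntegral hG 0 T

/-- **Joint smoothness of the periodic primitive** `H(p, t) = ∫₀ᵗ G(s, p) ds - t · A(p)`,
`A(p) = T⁻¹ ∫₀ᵀ G(s, p) ds`. [folklore] -/
theorem contDiff_periodicPrimitive {G : ℝ × P → ℝ} (hG : ContDiff ℝ ∞ G) (T : ℝ) :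
    ContDiff ℝ ∞ fun x : P × ℝ ↦
      (∫ s in (0 : ℝ)..x.2, G (s, x.1)) - x.2 * (T⁻¹ * ∫ s in (0 : ℝ)..T, G (s, x.1)) :=
  (contDiff_parametric_primitive hG).sub
    (contDiff_snd.mul (contDiff_const.mul ((contDiff_parametric_average hG T).comp contDiff_fst)))

omit [NormedSpace ℝ P] [FiniteDimensional ℝ P] in
/-- **`∂_t H = G - A`**: the periodic primitive solves the transport equation along the circle
with right-hand side `G` minus its average (fundamental theorem of calculus; `G` continuous).
[folklore] -/
theorem hasDerivAt_periodicPrimitive {G : ℝ × P → ℝ} (hG : Continuous G) (T : ℝ) (p : P) (t : ℝ) :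
    HasDerivAt (fun t : ℝ ↦
        (∫ s in (0 : ℝ)..t, G (s, p)) - t * (T⁻¹ * ∫ s in (0 : ℝ)..T, G (s, p)))
      (G (t, p) - T⁻¹ * ∫ s in (0 : ℝ)..T, G (s, p)) t := by
  have hc : Continuous fun s : ℝ ↦ G (s, p) := hG.comp (continuous_id.prodMk continuous_const)
  have h1 : HasDerivAt (fun u : ℝ ↦ ∫ s in (0 : ℝ)..u, G (s, p)) (G (t, p)) t :=
    (hc.integral_hasStrictDerivAt 0 t).hasDerivAt
  have h2 : HasDerivAt (fun u : ℝ ↦ u * (T⁻¹ * ∫ s in (0 : ℝ)..T, G (s, p)))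
      (T⁻¹ * ∫ s in (0 : ℝ)..T, G (s, p)) t := by
    simpa using (hasDerivAt_id t).mul_const (T⁻¹ * ∫ s in (0 : ℝ)..T, G (s, p))
  exact h1.sub h2

omit [NormedSpace ℝ P] [FiniteDimensional ℝ P] in
/-- **Periodicity of the primitive of a periodic function over one period**: if `G(·, p)` is
continuous and `T`-periodic then `∫₀^{t+T} G = ∫₀ᵗ G + ∫₀ᵀ G`. [folklore] -/
theorem integral_add_period {G : ℝ × P → ℝ} (hG : Continuous G) {T : ℝ} {p : P}
    (hper : ∀ s, G (s + T, p) = G (s, p)) (t : ℝ) :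
    ∫ s in (0 : ℝ)..t + T, G (s, p) =
      (∫ s in (0 : ℝ)..t, G (s, p)) + ∫ s in (0 : ℝ)..T, G (s, p) := by
  have hc : Continuous fun s : ℝ ↦ G (s, p) := hG.comp (continuous_id.prodMk continuous_const)
  have hint : ∀ a b : ℝ, IntervalIntegrable (fun s : ℝ ↦ G (s, p)) volume a b := fun a b ↦
    hc.intervalIntegrable a b
  rw [← integral_add_adjacent_intervals (hint 0 t) (hint t (t + T))]
  congr 1
  -- `∫_t^{t+T} G = ∫_0^T G` for a `T`-periodic function
  have hp : Function.Periodic (fun s : ℝ ↦ G (s, p)) T := fun s ↦ hper s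
  rw [hp.intervalIntegral_add_eq t 0, zero_add]

omit [NormedSpace ℝ P] [FiniteDimensional ℝ P] in
/-- **The periodic primitive is `T`-periodic in `t`** (`T ≠ 0`): subtracting `t` times the
average exactly cancels the increment `∫₀ᵀ G` over a period. [folklore] -/
theorem periodicPrimitive_add_period {G : ℝ × P → ℝ} (hG : Continuous G) {T : ℝ} (hT : T ≠ 0)
    {p : P} (hper : ∀ s, G (s + T, p) = G (s, p)) (t : ℝ) :
    (∫ s in (0 : ℝ)..t + T, G (s, p)) - (t + T) * (T⁻¹ * ∫ s in (0 : ℝ)..T, G (s, p)) =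
      (∫ s in (0 : ℝ)..t, G (s, p)) - t * (T⁻¹ * ∫ s in (0 : ℝ)..T, G (s, p)) := by
  rw [integral_add_period hG hper t]
  field_simp
  ring

/-- **Averaging along a circle with parameters** (summary; McDuff–Salamon 2017, §5.5; McLean
2012, proof of Lemma 5.17): for `G : ℝ × P → ℝ` of class `C^∞`, `T`-periodic in the first
variable (`T ≠ 0`), there are a `C^∞` function `H : P × ℝ → ℝ`, `T`-periodic in `t`, and the
`C^∞` average `A : P → ℝ`, `A p = T⁻¹ ∫₀ᵀ G(s, p) ds`, with `∂_t H (p, t) = G (t, p) - A p`.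
[cite: McDuffSalamon2017, §5.5 (averaging over a circle action)] -/
theorem exists_periodicPrimitive {G : ℝ × P → ℝ} (hG : ContDiff ℝ ∞ G) {T : ℝ} (hT : T ≠ 0)
    (hper : ∀ s p, G (s + T, p) = G (s, p)) :
    ∃ H : P × ℝ → ℝ, ContDiff ℝ ∞ H ∧ (∀ p t, H (p, t + T) = H (p, t)) ∧
      ∀ p t, HasDerivAt (fun t ↦ H (p, t)) (G (t, p) - T⁻¹ * ∫ s in (0 : ℝ)..T, G (s, p)) t :=
  ⟨fun x ↦ (∫ s in (0 : ℝ)..x.2, G (s, x.1)) - x.2 * (T⁻¹ * ∫ s in (0 : ℝ)..T, G (s, x.1)),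
    contDiff_periodicPrimitive hG T,
    fun p t ↦ periodicPrimitive_add_period hG.continuous hT (fun s ↦ hper s p) t,
    fun p t ↦ hasDerivAt_periodicPrimitive hG.continuous T p t⟩

end Literature.Analysis.FunctionSpaces
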